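import Summits.QuantumFields.YangMills.Theorems.BalabanUVNodesClusters
import Literature.MathematicalPhysics.QuantumFieldTheory.Balaban1983to89.B12NodeKnitRecord8
import Literature.MathematicalPhysics.QuantumFieldTheory.Balaban1983to89.Node00.N03Record
import Literature.MathematicalPhysics.QuantumFieldTheory.Balaban1983to89.Node00.Record8Inhabited

/-!
# BalabanUVNodes ∕ N09 at the record — the route stub SHAPE `YMDAG.UVSplit.S_N09 Rec` ([Balaban1987RG1] Sects. 2–5 + «Thm 3 ⇐ the remaining
# properties», `Dag.B12_main`) for EVERY record predicate `Rec` refining NODE 00's record predicate of record `Node00.IsRecordOfRecord₅C` from two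
# displayed Stage-5 slots, and at the Stage-8 record `IsRecordOfRecord₈C` from the B12-group pin + the [B11]-side inputs (seat n09-a's `B12NodeKnitRecord8`)
# (Track A, DAG node N09; cluster K2 «FlowBounds»; KNIT-BY-NAME seat `pub-ymgap-dag-n09-a`, plan's word (W2) «closers of record»)

HONEST FRAMING.  Count-neutral kernel bookkeeping: the route module's stub signature `S_N09 Rec := AtRecord Rec Dag.B12_main` (`BalabanUVNodesClustersCore`)
is CLOSED BY NAME, for every `Rec` refining `IsRecordOfRecord₅C`, MODULO two displayed slots at the Stage-5 parameters — (N09₅-leaf) «at every admissible θ and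
run P, Lemma 4 (3.53) holds over the B12 group of the residual carrier `θ.res.X P`» (the B12-GROUP PIN: at Stage 5 that group is FREE data; NODE 00 owes the
pin `(θ.res.X P).F12 = frameOf 𝓜 _ D`, seat n09-a's `N09-PIN-LIST.md`) and (N09₅-member) «at every admissible θ and run P of the assembled construction, the
interval hypothesis implies the inductive-assumption clauses `IndAss k`, k ≤ K» (at Stage 5 `IndAss` reads the residual FORMAT predicate `Residual₅.IndA`; at Stage 8
it is node00-def-B's `IndAOfRecord` and the member follows from [B11] Thm 1 at the record's objects + the composition clauses — `B12NodeKnitRecord8`).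
NOT a discharge of N09; nothing of Bałaban's asserted; one finite four-torus programme at fixed ε; nothing continuum ∕ ℝ⁴ ∕ OS ∕ mass-gap ∕ Clay.
0 `sorry`, 0 `def`, standard axioms.  Filed `--supports` item `StabilityBAtRecord` (stmt-QuantumFields-19183) of route «BalabanUVNodes» (LINE №12).

THE NODE.  `Dag.B12_main ℓ := ℓ.b4 → … → ℓ.b11 → (ℓ.b12 ∧ (ℓ.b12 → ℓ.b13 → (ℓ.smallCouplings → ℓ.smallFieldInductive)))` (Dag.lean :212);
`b12 = B12Sec2to5.Lemma4Printed F12 c12` (Lemma 4 (3.53) p. 280), the Theorem-3 member = Thm 1 p. 259 ∕ Thm 3 p. 264 for the run of the construction.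

WHAT THIS FILE PROVES (shape of record = dag-n04-a's `BalabanUVNodesN04AtRecord`).
* §1 `s_N09_iff` (`Iff.rfl`), `s_N09_antitone`, `s_N09_of_leaf_of_member` (the in-edges `b4 … b11`, `b13` are NOT consumed — no ex-falso route).
* §2 AT A C-BOUND RECORD: `b12_leaf_iff_of_up₅C` ∕ `_of_up₅` (the own leaf ↔ Lemma 4 over `θ.res.X P`, `Iff.rfl`), `thm3Member_iff_of_construction₅` (the member ↔ the
  clause at θ), and the two SOCKET IFFS **`forall_pinned_b12Leaf_iff₅C`** ∕ **`forall_member_iff₅C`**: the sockets «∀ admissible θ PRESENTING `D` and BINDING `w`, …»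
  are EQUIVALENT to the world's own leaf `∀ P, b12` ∕ member — census-neutral in strength, located at the residual carrier group the pin determines (no socket is
  quantified over ALL Stage-5 parameters, which junk residual carriers would falsify); `b12_main_of_isRecordOfRecord₅C_of_sockets` ∕ `₅`.
* §3 THE REFINEMENT-GENERIC CLOSERS (MANDATORY, (W2)): **`s_N09_of_refines₅C`**, `s_N09_of_refines₅`, instances `s_N09_rec₅C∕₇C_of_sockets`, `s_N09_rec₈C_of_sockets₅`;
  `s_N09_of_refines₅C_frameOf` — the leaf socket DISCHARGED by a family of frame pins (`B12Lemma4ConcreteFrame.lemma4Printed_frameOf`).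
* §4 THE STAGE-8 CLOSERS: **`s_N09_of_refines₈C`** — `S_N09 Rec` for every `Rec` refining `IsRecordOfRecord₈C` from the B12-group pin socket at the Stage-8 presenting
  parameters + [B11] Thm 1 at the record's domains (`UkExists ∧ UniqueUkOrbit` on `domAltOfRecord`) + the composition clauses `HCompT`
  (`B12NodeKnitRecord8.b12_main_at_record₈C_of_leaf` BY NAME; χ-locality and (0.20) are theorems there); `s_N09_rec₈C`.
* §5 VACUITY GUARDS (A5) + INHABITED-AT-₈C: at every run of every ₅C (hence ₇C, ₈C) record the in-edge leaves `b4 b5 b6 b7` HOLD (N01–N04 of record: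
  `Node00.b4∕b5∕b7_main_of_isRecordOfRecord₅C`, `Node00.N03_at_record₅C`), so no closer above is vacuous through them; `b8 … b11`, `b13` read residual carriers
  (their nodes' pins); `inhabited₈C_with_guards` (the zero-chart typing witness `Node00.Record8Inhabited.exists_isRecordOfRecord₈C` — DEGENERATE, chair R445 (A):
  at it neither slot is claimed; instance 0∕1 of N09 honest).
* §5b (v1.1, append-only) `s_N09_of_shadow₅C`, `atRecord_of_shadow₅C` — transfer of the ₅C closers ∕ of any `AtRecord` stub along a SAME-WORLD ₅C shadow
  (the ₉C → ₅C-at-shadow shape of def-T's `Record9`; `S_N09` reads the world only).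
* §6 `s_N09_of_flowBounds` — bookkeeping: `S_N09 Rec` is the N09 conjunct of K2 «FlowBounds» (the join `FlowBounds_of` ∕ `N10AtRecord.flowBounds_of_N10` is cited, not restated).
-/

noncomputable section

namespace Summit.QuantumFields.YangMills.BalabanUVNodes.N09AtRecord

open Literature.MathematicalPhysics.QuantumFieldTheory.Balaban1983to89
open Literature.MathematicalPhysics.QuantumFieldTheory.Balaban1983to89.T4Continuum (T4Family FiniteEpsData)
open Literature.MathematicalPhysics.QuantumFieldTheory.Balaban1983to89.DagBinding (WorldP leavesP)
open Literature.MathematicalPhysics.QuantumFieldTheory.Balaban1983to89.Node00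
open Literature.MathematicalPhysics.QuantumFieldTheory.Balaban1983to89.B12NodeKnitRecord8
  (b12_main_of_leaf_of_thm3Member b12_main_at_record₈C_of_leaf b12_leaf_stage8_iff)
open Literature.MathematicalPhysics.QuantumFieldTheory.Balaban1983to89.B12RegularSpaces111 (Model)
open Literature.MathematicalPhysics.QuantumFieldTheory.Balaban1983to89.B12Lemma4ConcreteFrame (Lemma4Data frameOf lemma4Printed_frameOf)
open FlowStepRuns (genSeq)
open YMDAG.UVSplit (RecordPred Datum AtRecord S_N09 FlowBounds)

variable {N : ℕ} [NeZero N]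

/-! ## §1 The stub unfolded; antitone in `Rec`; from the own leaf and the Theorem-3 member -/

/-- **What `S_N09 Rec` says** (`Iff.rfl`): at every run of every binding world of every record pair, `Dag.B12_main` — «in-edges `b4 … b11` ⇒ (Lemma 4 over the
run's B12 group) ∧ (… → `b13` → interval hypothesis ⇒ inductive assumptions at every level `k ≤ K`)». [cite: Balaban1987RG1, Lemma 4 (3.53) p.280, Thm 1 p.259 and Thm 3 p.264 (the node's content; bookkeeping)] -/
theorem s_N09_iff (Rec : RecordPred N) :
    S_N09 Rec ↔ ∀ (F : T4Family) (D : Datum F N) (w : WorldP), Rec F D w → ∀ P : B12.RunParams, Dag.B12_main (leavesP w P) :=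
  Iff.rfl

/-- **`S_N09` is ANTITONE in the record predicate**: proved at `Rec`, it holds at every `Rec'` refining `Rec`. [cite: Balaban1987RG1, Thm 3 p.264 (bookkeeping)] -/
theorem s_N09_antitone {Rec Rec' : RecordPred N}
    (hle : ∀ (F : T4Family) (D : Datum F N) (w : WorldP), Rec' F D w → Rec F D w) (h : S_N09 Rec) : S_N09 Rec' :=
  fun F D w hR P => h F D w (hle F D w hR) P

/-- `S_N09 Rec` from N09's OWN LEAF `b12` and its Theorem-3 member at every run (the in-edges `b4 … b11`, `b13` are not consumed — how every closer below concludes).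
[cite: Balaban1987RG1, Lemma 4 (3.53) p.280 and Thm 3 p.264 (bookkeeping)] -/
theorem s_N09_of_leaf_of_member (Rec : RecordPred N)
    (h : ∀ (F : T4Family) (D : Datum F N) (w : WorldP), Rec F D w → ∀ P : B12.RunParams,
      (leavesP w P).b12 ∧ ((leavesP w P).smallCouplings → (leavesP w P).smallFieldInductive)) : S_N09 Rec :=
  fun F D w hR P => b12_main_of_leaf_of_thm3Member (h F D w hR P).1 (h F D w hR P).2

/-! ## §2 At a C-bound record: the own leaf and the member located at the record's PRESENTING Stage-5 parameters (sockets ↔ the world's leaves) -/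

section Stage5

variable {F : T4Family}

/-- **The own leaf at a run bound by the C-binding of record** (`w.up P = upOfRecord₅C θ P`): `(leavesP w P).b12` ↔ Lemma 4 (3.53) over the B12 group of the
residual carrier `θ.res.X P` (`Iff.rfl`: the Stage-3 substitutions and the `b10` re-binding never touch the B12 group). [cite: Balaban1987RG1, Lemma 4 (3.53) p.280 (the leaf at the record; bookkeeping)] -/
theorem b12_leaf_iff_of_up₅C (θ : Stage5Params F N) {w : WorldP} (P : B12.RunParams) (hup : w.up P = upOfRecord₅C F N θ P) :
    (leavesP w P).b12 ↔ B12Sec2to5.Lemma4Printed (θ.res.X P).F12 (θ.res.X P).c12 := by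
  show (w.up P).b12 ↔ _
  rw [hup]
  exact Iff.rfl

/-- The same at a run bound by the N-binding `upOfRecord₅ θ P` (`Node00.Record5`). [cite: Balaban1987RG1, Lemma 4 (3.53) p.280 (bookkeeping)] -/
theorem b12_leaf_iff_of_up₅ (θ : Stage5Params F N) {w : WorldP} (P : B12.RunParams) (hup : w.up P = upOfRecord₅ F N θ P) :
    (leavesP w P).b12 ↔ B12Sec2to5.Lemma4Printed (θ.res.X P).F12 (θ.res.X P).c12 := by
  show (w.up P).b12 ↔ _
  rw [hup]
  exact Iff.rfl

/-- **The Theorem-3 member at a run of a world bound to the assembled construction at `θ` with `w.γ = θ.γ`** ↔ the clause at `θ`: «interval hypothesis along the run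
of `(datumOfRecord₅ θ).C` ⇒ `IndAss k`, k ≤ K» (at Stage 5 `IndAss` reads the residual format predicate `θ.res.IndA` at the record's objects; at Stage 8 it is node00-def-B's
`IndAOfRecord`). [cite: Balaban1987RG1, Thm 1 p.259 and Thm 3 p.264 (the member at the record; bookkeeping)] -/
theorem thm3Member_iff_of_construction₅ (θ : Stage5Params F N) {w : WorldP} (P : B12.RunParams) (hC : w.C = (datumOfRecord₅ F N θ).C)
    (hγ : w.γ = θ.γ) :
    ((leavesP w P).smallCouplings → (leavesP w P).smallFieldInductive) ↔
      (((datumOfRecord₅ F N θ).C P).flow.InInterval θ.γ P.K → ∀ k, k ≤ P.K → ((datumOfRecord₅ F N θ).C P).IndAss k) := by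
  show ((w.C P).flow.InInterval w.γ P.K → ∀ k, k ≤ P.K → (w.C P).IndAss k) ↔ _
  rw [hC, hγ]

variable {D : FiniteEpsData F (Node00.SU N)} {w : WorldP}

/-- **SOCKET (N09₅-leaf) ↔ THE WORLD's OWN LEAF**: at a ₅C record, «for every admissible Stage-5 parameter PRESENTING `D` and BINDING `w.up`, Lemma 4 over `θ.res.X P` at every
run» is EQUIVALENT to `∀ P, (leavesP w P).b12` — so displaying the socket instead of the leaf is census-neutral in strength and positive in location (it names the
residual carrier group NODE 00's pin determines).  Pattern of n24-a's `Node00.N24_forall_pinned_b8Leaf_iff₅C`. [cite: Balaban1987RG1, Lemma 4 (3.53) p.280 (bookkeeping)] -/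
theorem forall_pinned_b12Leaf_iff₅C (h : IsRecordOfRecord₅C F N D w) :
    (∀ θ : Stage5Params F N, θ.Admissible → D = datumOfRecord₅ F N θ → (∀ P, w.up P = upOfRecord₅C F N θ P) →
        ∀ P : B12.RunParams, B12Sec2to5.Lemma4Printed (θ.res.X P).F12 (θ.res.X P).c12) ↔
      ∀ P : B12.RunParams, (leavesP w P).b12 := by
  refine ⟨fun hX P => ?_, fun hw θ' _ _ hup' P => (b12_leaf_iff_of_up₅C θ' P (hup' P)).1 (hw P)⟩
  obtain ⟨θ, hθ, hD, -, -, -, hup⟩ := h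
  exact (b12_leaf_iff_of_up₅C θ P (hup P)).2 (hX θ hθ hD hup P)

/-- **SOCKET (N09₅-member) ↔ THE WORLD's THEOREM-3 MEMBER**: at a ₅C record, «for every admissible Stage-5 parameter presenting `D` with `w.C = D.C`, `w.γ = θ.γ`, the
inductive-assumption clauses along in-interval runs of the assembled construction» is EQUIVALENT to the member `smallCouplings → smallFieldInductive` at every run.
[cite: Balaban1987RG1, Thm 1 p.259 and Thm 3 p.264 (bookkeeping)] -/
theorem forall_member_iff₅C (h : IsRecordOfRecord₅C F N D w) :
    (∀ θ : Stage5Params F N, θ.Admissible → D = datumOfRecord₅ F N θ → w.C = D.C → w.γ = θ.γ → ∀ P : B12.RunParams,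
        ((datumOfRecord₅ F N θ).C P).flow.InInterval θ.γ P.K → ∀ k, k ≤ P.K → ((datumOfRecord₅ F N θ).C P).IndAss k) ↔
      ∀ P : B12.RunParams, (leavesP w P).smallCouplings → (leavesP w P).smallFieldInductive := by
  refine ⟨fun hT P => ?_, fun hw θ' _ hD' hC' hγ' P => ?_⟩
  · obtain ⟨θ, hθ, hD, hC, hγ, -, -⟩ := h
    have hC' : w.C = (datumOfRecord₅ F N θ).C := by rw [hC, hD]
    exact (thm3Member_iff_of_construction₅ θ P hC' hγ).2 (hT θ hθ hD hC hγ P)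
  · have hC'' : w.C = (datumOfRecord₅ F N θ').C := by rw [hC', hD']
    exact (thm3Member_iff_of_construction₅ θ' P hC'' hγ').1 (hw P)

/-- **N09 AT EVERY RUN OF A STAGE-5 RECORD (C-binding) from the two sockets** over the record's presenting parameters. [cite: Balaban1987RG1, Lemma 4 (3.53) p.280, Thm 1 p.259 and Thm 3 p.264] -/
theorem b12_main_of_isRecordOfRecord₅C_of_sockets (h : IsRecordOfRecord₅C F N D w)
    (slot12 : ∀ θ : Stage5Params F N, θ.Admissible → D = datumOfRecord₅ F N θ → (∀ P, w.up P = upOfRecord₅C F N θ P) →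
      ∀ P : B12.RunParams, B12Sec2to5.Lemma4Printed (θ.res.X P).F12 (θ.res.X P).c12)
    (slotT : ∀ θ : Stage5Params F N, θ.Admissible → D = datumOfRecord₅ F N θ → w.C = D.C → w.γ = θ.γ → ∀ P : B12.RunParams,
      ((datumOfRecord₅ F N θ).C P).flow.InInterval θ.γ P.K → ∀ k, k ≤ P.K → ((datumOfRecord₅ F N θ).C P).IndAss k)
    (P : B12.RunParams) : Dag.B12_main (leavesP w P) :=
  b12_main_of_leaf_of_thm3Member ((forall_pinned_b12Leaf_iff₅C h).1 slot12 P) ((forall_member_iff₅C h).1 slotT P)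

/-- The same at a Stage-5 record in the N-binding sense (`Node00.IsRecordOfRecord₅`; the binding socket reads `upOfRecord₅`). [cite: Balaban1987RG1, Lemma 4 (3.53) p.280, Thm 1 p.259 and Thm 3 p.264] -/
theorem b12_main_of_isRecordOfRecord₅_of_sockets (h : IsRecordOfRecord₅ F N D w)
    (slot12 : ∀ θ : Stage5Params F N, θ.Admissible → D = datumOfRecord₅ F N θ → (∀ P, w.up P = upOfRecord₅ F N θ P) →
      ∀ P : B12.RunParams, B12Sec2to5.Lemma4Printed (θ.res.X P).F12 (θ.res.X P).c12)
    (slotT : ∀ θ : Stage5Params F N, θ.Admissible → D = datumOfRecord₅ F N θ → w.C = D.C → w.γ = θ.γ → ∀ P : B12.RunParams,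
      ((datumOfRecord₅ F N θ).C P).flow.InInterval θ.γ P.K → ∀ k, k ≤ P.K → ((datumOfRecord₅ F N θ).C P).IndAss k)
    (P : B12.RunParams) : Dag.B12_main (leavesP w P) := by
  obtain ⟨θ, hθ, hD, hC, hγ, -, hup⟩ := h
  have hC' : w.C = (datumOfRecord₅ F N θ).C := by rw [hC, hD]
  exact b12_main_of_leaf_of_thm3Member ((b12_leaf_iff_of_up₅ θ P (hup P)).2 (slot12 θ hθ hD hup P))
    ((thm3Member_iff_of_construction₅ θ P hC' hγ).2 (slotT θ hθ hD hC hγ P))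

end Stage5

/-! ## §3 THE REFINEMENT-GENERIC CLOSERS over Stage 5 (plan's word (W2): MANDATORY shape); the sockets are quantified over the records of `Rec` and
their presenting parameters — so, by §2, each is EXACTLY the corresponding world leaf ∕ member (no universal-over-all-θ socket, which junk carriers would falsify) -/

/-- **REFINEMENT-GENERIC CLOSER, C-binding**: `S_N09 Rec` for EVERY record predicate refining NODE 00's record predicate of record `IsRecordOfRecord₅C`, from the two
sockets (N09₅-leaf) and (N09₅-member) at the presenting parameters of every record of `Rec`.  `Rec` refining `IsRecordOfRecord₅C` covers ₅C itself, ₇C ∕ ₈C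
(`Node00.isRecordOfRecord₅C_of_isRecordOfRecord₇C ∕ ₈C`) and the ₉C re-base once its refinement to ₅C lands.
[cite: Balaban1987RG1, Lemma 4 (3.53) p.280, Thm 1 p.259 and Thm 3 p.264 (kernel shape at the objects of record, C-binding)] -/
theorem s_N09_of_refines₅C (Rec : RecordPred N)
    (href : ∀ (F : T4Family) (D : Datum F N) (w : WorldP), Rec F D w → IsRecordOfRecord₅C F N D w)
    (slot12 : ∀ (F : T4Family) (D : Datum F N) (w : WorldP), Rec F D w →
      ∀ θ : Stage5Params F N, θ.Admissible → D = datumOfRecord₅ F N θ → (∀ P, w.up P = upOfRecord₅C F N θ P) →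
        ∀ P : B12.RunParams, B12Sec2to5.Lemma4Printed (θ.res.X P).F12 (θ.res.X P).c12)
    (slotT : ∀ (F : T4Family) (D : Datum F N) (w : WorldP), Rec F D w →
      ∀ θ : Stage5Params F N, θ.Admissible → D = datumOfRecord₅ F N θ → w.C = D.C → w.γ = θ.γ → ∀ P : B12.RunParams,
        ((datumOfRecord₅ F N θ).C P).flow.InInterval θ.γ P.K → ∀ k, k ≤ P.K → ((datumOfRecord₅ F N θ).C P).IndAss k) :
    S_N09 Rec :=
  fun F D w hR P => b12_main_of_isRecordOfRecord₅C_of_sockets (href F D w hR) (slot12 F D w hR) (slotT F D w hR) P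

/-- **REFINEMENT-GENERIC CLOSER, N-binding** (`Node00.IsRecordOfRecord₅`, the literal-`b10` twin of the record predicate of record), from the two sockets.
[cite: Balaban1987RG1, Lemma 4 (3.53) p.280, Thm 1 p.259 and Thm 3 p.264 (kernel shape at the objects of record, N-binding)] -/
theorem s_N09_of_refines₅ (Rec : RecordPred N)
    (href : ∀ (F : T4Family) (D : Datum F N) (w : WorldP), Rec F D w → IsRecordOfRecord₅ F N D w)
    (slot12 : ∀ (F : T4Family) (D : Datum F N) (w : WorldP), Rec F D w →
      ∀ θ : Stage5Params F N, θ.Admissible → D = datumOfRecord₅ F N θ → (∀ P, w.up P = upOfRecord₅ F N θ P) →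
        ∀ P : B12.RunParams, B12Sec2to5.Lemma4Printed (θ.res.X P).F12 (θ.res.X P).c12)
    (slotT : ∀ (F : T4Family) (D : Datum F N) (w : WorldP), Rec F D w →
      ∀ θ : Stage5Params F N, θ.Admissible → D = datumOfRecord₅ F N θ → w.C = D.C → w.γ = θ.γ → ∀ P : B12.RunParams,
        ((datumOfRecord₅ F N θ).C P).flow.InInterval θ.γ P.K → ∀ k, k ≤ P.K → ((datumOfRecord₅ F N θ).C P).IndAss k) :
    S_N09 Rec :=
  fun F D w hR P => b12_main_of_isRecordOfRecord₅_of_sockets (href F D w hR) (slot12 F D w hR) (slotT F D w hR) P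

/-- `S_N09` AT THE RECORD PREDICATE OF RECORD ITSELF (`Rec := IsRecordOfRecord₅C`), from the two sockets. [cite: Balaban1987RG1, Lemma 4 (3.53) p.280 and Thm 3 p.264] -/
theorem s_N09_rec₅C_of_sockets
    (slot12 : ∀ (F : T4Family) (D : Datum F N) (w : WorldP), IsRecordOfRecord₅C F N D w →
      ∀ θ : Stage5Params F N, θ.Admissible → D = datumOfRecord₅ F N θ → (∀ P, w.up P = upOfRecord₅C F N θ P) →
        ∀ P : B12.RunParams, B12Sec2to5.Lemma4Printed (θ.res.X P).F12 (θ.res.X P).c12)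
    (slotT : ∀ (F : T4Family) (D : Datum F N) (w : WorldP), IsRecordOfRecord₅C F N D w →
      ∀ θ : Stage5Params F N, θ.Admissible → D = datumOfRecord₅ F N θ → w.C = D.C → w.γ = θ.γ → ∀ P : B12.RunParams,
        ((datumOfRecord₅ F N θ).C P).flow.InInterval θ.γ P.K → ∀ k, k ≤ P.K → ((datumOfRecord₅ F N θ).C P).IndAss k) :
    S_N09 (fun F D w => IsRecordOfRecord₅C F N D w) :=
  s_N09_of_refines₅C _ (fun _ _ _ h => h) slot12 slotT

/-- `S_N09` AT THE STAGE-7 RECORD (`Rec := IsRecordOfRecord₇C`, refining ₅C by `Node00.isRecordOfRecord₅C_of_isRecordOfRecord₇C`), sockets at the Stage-5 presentations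
of the ₇C records. [cite: Balaban1987RG1, Lemma 4 (3.53) p.280 and Thm 3 p.264] -/
theorem s_N09_rec₇C_of_sockets
    (slot12 : ∀ (F : T4Family) (D : Datum F N) (w : WorldP), IsRecordOfRecord₇C F N D w →
      ∀ θ : Stage5Params F N, θ.Admissible → D = datumOfRecord₅ F N θ → (∀ P, w.up P = upOfRecord₅C F N θ P) →
        ∀ P : B12.RunParams, B12Sec2to5.Lemma4Printed (θ.res.X P).F12 (θ.res.X P).c12)
    (slotT : ∀ (F : T4Family) (D : Datum F N) (w : WorldP), IsRecordOfRecord₇C F N D w →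
      ∀ θ : Stage5Params F N, θ.Admissible → D = datumOfRecord₅ F N θ → w.C = D.C → w.γ = θ.γ → ∀ P : B12.RunParams,
        ((datumOfRecord₅ F N θ).C P).flow.InInterval θ.γ P.K → ∀ k, k ≤ P.K → ((datumOfRecord₅ F N θ).C P).IndAss k) :
    S_N09 (fun F D w => IsRecordOfRecord₇C F N D w) :=
  s_N09_of_refines₅C _ (fun _ _ _ h => isRecordOfRecord₅C_of_isRecordOfRecord₇C h) slot12 slotT

/-- `S_N09` AT THE STAGE-8 RECORD (`Rec := IsRecordOfRecord₈C`, refining ₅C by `Node00.isRecordOfRecord₅C_of_isRecordOfRecord₈C`), sockets at the Stage-5 presentations of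
the ₈C records (the Stage-8-native closer with the member socket replaced by [B11]-side inputs is §4). [cite: Balaban1987RG1, Lemma 4 (3.53) p.280 and Thm 3 p.264] -/
theorem s_N09_rec₈C_of_sockets₅
    (slot12 : ∀ (F : T4Family) (D : Datum F N) (w : WorldP), IsRecordOfRecord₈C F N D w →
      ∀ θ : Stage5Params F N, θ.Admissible → D = datumOfRecord₅ F N θ → (∀ P, w.up P = upOfRecord₅C F N θ P) →
        ∀ P : B12.RunParams, B12Sec2to5.Lemma4Printed (θ.res.X P).F12 (θ.res.X P).c12)
    (slotT : ∀ (F : T4Family) (D : Datum F N) (w : WorldP), IsRecordOfRecord₈C F N D w →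
      ∀ θ : Stage5Params F N, θ.Admissible → D = datumOfRecord₅ F N θ → w.C = D.C → w.γ = θ.γ → ∀ P : B12.RunParams,
        ((datumOfRecord₅ F N θ).C P).flow.InInterval θ.γ P.K → ∀ k, k ≤ P.K → ((datumOfRecord₅ F N θ).C P).IndAss k) :
    S_N09 (fun F D w => IsRecordOfRecord₈C F N D w) :=
  s_N09_of_refines₅C _ (fun _ _ _ h => isRecordOfRecord₅C_of_isRecordOfRecord₈C h) slot12 slotT

/-- **`S_N09 Rec` WITH THE LEAF SOCKET DISCHARGED BY A FAMILY OF FRAME PINS** (every `Rec` refining ₅C): if a later NODE-00 stage proves, for every record of `Rec` and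
each of its presenting∕binding Stage-5 parameters `θ`, that the B12 frame of the residual carrier at every run is the concrete Lemma-4 frame of a package of the
by-reference inputs of Lemma 4's proof (`hF`), then conjunct 1 holds by `B12Lemma4ConcreteFrame.lemma4Printed_frameOf` and only the member socket remains.
[cite: Balaban1987RG1, Lemma 4 (3.53) p.280 (on the concrete frame) and Thm 3 p.264] -/
theorem s_N09_of_refines₅C_frameOf (Rec : RecordPred N)
    (href : ∀ (F : T4Family) (D : Datum F N) (w : WorldP), Rec F D w → IsRecordOfRecord₅C F N D w)
    {𝔸 : Type} [NormedRing 𝔸] [NormedAlgebra ℂ 𝔸] [CompleteSpace 𝔸] [NormOneClass 𝔸] {𝓜 : Model 𝔸}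
    (hF : ∀ (F : T4Family) (D : Datum F N) (w : WorldP), Rec F D w →
      ∀ θ : Stage5Params F N, θ.Admissible → D = datumOfRecord₅ F N θ → (∀ P, w.up P = upOfRecord₅C F N θ P) → ∀ P : B12.RunParams,
        ∃ (Q : Params) (i : ℕ) (D' : Lemma4Data Q i 𝓜 (θ.res.X P).c12), (θ.res.X P).F12 = frameOf 𝓜 (θ.res.X P).c12 D')
    (slotT : ∀ (F : T4Family) (D : Datum F N) (w : WorldP), Rec F D w →
      ∀ θ : Stage5Params F N, θ.Admissible → D = datumOfRecord₅ F N θ → w.C = D.C → w.γ = θ.γ → ∀ P : B12.RunParams,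
        ((datumOfRecord₅ F N θ).C P).flow.InInterval θ.γ P.K → ∀ k, k ≤ P.K → ((datumOfRecord₅ F N θ).C P).IndAss k) :
    S_N09 Rec :=
  s_N09_of_refines₅C Rec href (fun F D w hR θ hθ hD hup P => by
    obtain ⟨Q, i, D', hF'⟩ := hF F D w hR θ hθ hD hup P
    rw [hF']
    exact lemma4Printed_frameOf D') slotT

/-! ## §4 THE STAGE-8 CLOSERS: the member socket replaced by [B11] Thm 1 at the record's domains + the composition clauses (`B12NodeKnitRecord8`) -/

/-- **`S_N09 Rec` FOR EVERY RECORD PREDICATE REFINING THE STAGE-8 RECORD `IsRecordOfRecord₈C`**, from three binders over the Stage-8 parameters presenting each record of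
`Rec` (the binders of `B12NodeKnitRecord8.b12_main_at_record₈C_of_leaf`, BY NAME): (N09₈-leaf) the B12-group pin «Lemma 4 over `θ.res.X P`» at the binding parameters,
(c) [B11] Thm 1 at the record's level-`k` domains — `UkExists ∧ UniqueUkOrbit` on `domAltOfRecord θ.ν p.K k` ([Balaban1985Variational] Thm 1 = N07's content at the record,
GAPS G₈a-1∕-2) —, (d) the composition clauses `HCompT` of (0.23) ((0.21) p. 256, (2.16) p. 269); χ-locality and (0.20)-in-history-form are theorems there.
[cite: Balaban1987RG1, Lemma 4 (3.53) p.280, Thm 3 p.264, (1.1)–(1.3) p.260 and (0.22)–(0.23) p.256; Balaban1985Variational, Thm 1 p.279] -/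
theorem s_N09_of_refines₈C (Rec : RecordPred N)
    (href : ∀ (F : T4Family) (D : Datum F N) (w : WorldP), Rec F D w → IsRecordOfRecord₈C F N D w)
    (slot12 : ∀ (F : T4Family) (D : Datum F N) (w : WorldP), Rec F D w →
      ∀ θ : Stage8Params F N, θ.Admissible → D = datumOfRecord₅ F N (θ.toStage5 F N) → w.γ ≤ θ.γ →
        (∀ P, w.up P = upOfRecord₅C F N (θ.toStage5 F N) P) → ∀ P : B12.RunParams, B12Sec2to5.Lemma4Printed (θ.res.X P).F12 (θ.res.X P).c12)
    (h11 : ∀ (F : T4Family) (D : Datum F N) (w : WorldP), Rec F D w →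
      ∀ θ : Stage8Params F N, θ.Admissible → D = datumOfRecord₅ F N (θ.toStage5 F N) → w.γ ≤ θ.γ →
        ∀ (p : B12.RunParams) (k : ℕ), k ≤ p.K →
          ∀ V ∈ domAltOfRecord F N θ.ν p.K k, UkExists F N p.K k θ.εbg V ∧ UniqueUkOrbit F N p.K k θ.εbg V)
    (hcomp : ∀ (F : T4Family) (D : Datum F N) (w : WorldP), Rec F D w →
      ∀ θ : Stage8Params F N, θ.Admissible → D = datumOfRecord₅ F N (θ.toStage5 F N) → w.γ ≤ θ.γ →
        ∀ (p : B12.RunParams) (k : ℕ), k ≤ p.K →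
          HCompT F N (TOfRecord F N) (chi7 F N θ) θ.εbg p.K (genSeq (betaOfRecord₈ F N θ) p.g0) k (domAltOfRecord F N θ.ν p.K k)) :
    S_N09 Rec :=
  fun F D w hR P => b12_main_at_record₈C_of_leaf (href F D w hR) (slot12 F D w hR) (h11 F D w hR) (hcomp F D w hR) P

/-- **`S_N09` AT THE STAGE-8 RECORD ITSELF** from the three Stage-8 binders. [cite: Balaban1987RG1, Lemma 4 (3.53) p.280, Thm 3 p.264 and (1.1)–(1.3) p.260] -/
theorem s_N09_rec₈C
    (slot12 : ∀ (F : T4Family) (D : Datum F N) (w : WorldP), IsRecordOfRecord₈C F N D w →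
      ∀ θ : Stage8Params F N, θ.Admissible → D = datumOfRecord₅ F N (θ.toStage5 F N) → w.γ ≤ θ.γ →
        (∀ P, w.up P = upOfRecord₅C F N (θ.toStage5 F N) P) → ∀ P : B12.RunParams, B12Sec2to5.Lemma4Printed (θ.res.X P).F12 (θ.res.X P).c12)
    (h11 : ∀ (F : T4Family) (D : Datum F N) (w : WorldP), IsRecordOfRecord₈C F N D w →
      ∀ θ : Stage8Params F N, θ.Admissible → D = datumOfRecord₅ F N (θ.toStage5 F N) → w.γ ≤ θ.γ →
        ∀ (p : B12.RunParams) (k : ℕ), k ≤ p.K →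
          ∀ V ∈ domAltOfRecord F N θ.ν p.K k, UkExists F N p.K k θ.εbg V ∧ UniqueUkOrbit F N p.K k θ.εbg V)
    (hcomp : ∀ (F : T4Family) (D : Datum F N) (w : WorldP), IsRecordOfRecord₈C F N D w →
      ∀ θ : Stage8Params F N, θ.Admissible → D = datumOfRecord₅ F N (θ.toStage5 F N) → w.γ ≤ θ.γ →
        ∀ (p : B12.RunParams) (k : ℕ), k ≤ p.K →
          HCompT F N (TOfRecord F N) (chi7 F N θ) θ.εbg p.K (genSeq (betaOfRecord₈ F N θ) p.g0) k (domAltOfRecord F N θ.ν p.K k)) :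
    S_N09 (fun F D w => IsRecordOfRecord₈C F N D w) :=
  s_N09_of_refines₈C _ (fun _ _ _ h => h) slot12 h11 hcomp

/-! ## §5 VACUITY GUARDS at the C-bound records (A5): the in-edge leaves `b4 b5 b6 b7` HOLD; INHABITED-AT-₈C -/

section Guards

variable {F : T4Family} {D : FiniteEpsData F (SU N)} {w : WorldP}

/-- **In-edge guards, ₅C**: at every run of a Stage-5 (C-bound) record the in-edge leaves `b4`, `b5`, `b6`, `b7` of N09 HOLD — N01, N02, N03, N04 are NODE 00
theorems there (`Node00.b4∕b5∕b7_main_of_isRecordOfRecord₅C`, `Node00.N03_at_record₅C`).  The leaves `b8 … b11`, `b13` read residual carriers (their nodes' pins)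
and are not asserted. [cite: Balaban1983RegularityDecay, Theorem p.573; Balaban1984PropagatorsI, Props. 1.1–1.2 pp.33–36; Balaban1984PropagatorsII, Lemma 2.1 – Cor. 2.8 pp.234–249; Balaban1985Averaging, Props. 1–10 pp.26–50 (kernel versions at the objects of record)] -/
theorem guards_of_isRecordOfRecord₅C (h : IsRecordOfRecord₅C F N D w) (P : B12.RunParams) :
    (leavesP w P).b4 ∧ (leavesP w P).b5 ∧ (leavesP w P).b6 ∧ (leavesP w P).b7 := by
  have h4 : (leavesP w P).b4 := b4_main_of_isRecordOfRecord₅C h P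
  have h5 : (leavesP w P).b5 := b5_main_of_isRecordOfRecord₅C h P h4
  exact ⟨h4, h5, N03_at_record₅C h P h4 h5, b7_main_of_isRecordOfRecord₅C h P h5⟩

/-- In-edge guards at every run of a Stage-7 record (`₇C → ₅C`). [cite: Balaban1985Averaging, Props. 1–10 pp.26–50 (bookkeeping)] -/
theorem guards_of_isRecordOfRecord₇C (h : IsRecordOfRecord₇C F N D w) (P : B12.RunParams) :
    (leavesP w P).b4 ∧ (leavesP w P).b5 ∧ (leavesP w P).b6 ∧ (leavesP w P).b7 :=
  guards_of_isRecordOfRecord₅C (isRecordOfRecord₅C_of_isRecordOfRecord₇C h) P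

/-- In-edge guards at every run of a Stage-8 record (`₈C → ₅C`; the four leaves are chart-free, so the zero-chart members of the class are no exception).
[cite: Balaban1985Averaging, Props. 1–10 pp.26–50 (bookkeeping)] -/
theorem guards_of_isRecordOfRecord₈C (h : IsRecordOfRecord₈C F N D w) (P : B12.RunParams) :
    (leavesP w P).b4 ∧ (leavesP w P).b5 ∧ (leavesP w P).b6 ∧ (leavesP w P).b7 :=
  guards_of_isRecordOfRecord₅C (isRecordOfRecord₅C_of_isRecordOfRecord₈C h) P

/-- **At a ₅C record N09 IS «b8 → b9 → b10 → b11 → (b12 ∧ member)»**: the four discharged in-edges drop out of the node statement (kernel form of the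
in-edge vacuity map for N09 at the record). [cite: Balaban1987RG1, Lemma 4 (3.53) p.280 and Thm 3 p.264 (bookkeeping)] -/
theorem b12_main_iff_of_isRecordOfRecord₅C (h : IsRecordOfRecord₅C F N D w) (P : B12.RunParams) :
    Dag.B12_main (leavesP w P) ↔
      ((leavesP w P).b8 → (leavesP w P).b9 → (leavesP w P).b10 → (leavesP w P).b11 →
        ((leavesP w P).b12 ∧ ((leavesP w P).b12 → (leavesP w P).b13 → ((leavesP w P).smallCouplings → (leavesP w P).smallFieldInductive)))) := by
  obtain ⟨h4, h5, h6, h7⟩ := guards_of_isRecordOfRecord₅C h P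
  exact ⟨fun hN h8 h9 h10 h11 => hN h4 h5 h6 h7 h8 h9 h10 h11, fun hN _ _ _ _ h8 h9 h10 h11 => hN h8 h9 h10 h11⟩

end Guards

/-- **INHABITED-AT-₈C, WITH N09's IN-EDGE GUARDS**: on every four-torus family there is a Stage-8 record (`Node00.Record8Inhabited.exists_isRecordOfRecord₈C` — the
zero-chart typing witness, DEGENERATE, chair R445 (A): NOT an object of record), and at each of its runs the in-edge leaves `b4 b5 b6 b7` hold — so no closer above
quantifies over an empty class and none is vacuous through those in-edges.  Neither slot of N09 is claimed at the witness (its `Residual₅.X` and `IndA` objects are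
whatever the witness carries): instance 0∕1 of N09, honestly. [cite: Balaban1987RG1, (0.17)–(0.22) pp.255–256 (bookkeeping witness); Balaban1985Averaging, Props. 1–10 pp.26–50] -/
theorem inhabited₈C_with_guards (F : T4Family) :
    ∃ (D : FiniteEpsData F (SU N)) (w : WorldP), IsRecordOfRecord₈C F N D w ∧
      ∀ P : B12.RunParams, (leavesP w P).b4 ∧ (leavesP w P).b5 ∧ (leavesP w P).b6 ∧ (leavesP w P).b7 := by
  obtain ⟨D, w, h⟩ := Record8Inhabited.exists_isRecordOfRecord₈C F N
  exact ⟨D, w, h, fun P => guards_of_isRecordOfRecord₈C h P⟩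

/-- The same at the record predicate of record ₅C (through `₈C → ₅C`). [cite: Balaban1989LargeFieldII, Thm 1 p.355 (bookkeeping witness)] -/
theorem inhabited₅C_with_guards (F : T4Family) :
    ∃ (D : FiniteEpsData F (SU N)) (w : WorldP), IsRecordOfRecord₅C F N D w ∧
      ∀ P : B12.RunParams, (leavesP w P).b4 ∧ (leavesP w P).b5 ∧ (leavesP w P).b6 ∧ (leavesP w P).b7 := by
  obtain ⟨D, w, h, hg⟩ := inhabited₈C_with_guards (N := N) F
  exact ⟨D, w, isRecordOfRecord₅C_of_isRecordOfRecord₈C h, hg⟩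

/-! ## §5b (v1.1, append-only) TRANSFER ALONG A SHADOW: `S_N09` reads the WORLD only, so any record predicate whose records admit a ₅C record WITH THE SAME
WORLD inherits the ₅C closers (the shape of NODE 00 Stage 9's `exists_isRecordOfRecord₅C_of_isRecordOfRecord₉C` ∕ `atWorld_of_isRecordOfRecord₉C` — LOCATED COST 2
of def-T's `Record9` INTENT: ₉C ↛ ₅C at the datum, but ₉C → ₅C at the shadow datum, same `w`) -/

/-- **`S_N09 Rec` FROM A ₅C SHADOW WITH THE SAME WORLD**: if every record `(D, w)` of `Rec` admits SOME Stage-5 (C-binding) record `(D₅, w)` with the same binding world,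
then the two ₅C sockets — quantified over the ₅C records and their presenting parameters — close `S_N09 Rec` (the node statement reads `leavesP w P` only).
The ₉C instance is one application to `Node00.exists_isRecordOfRecord₅C_of_isRecordOfRecord₉C` once `Node00.Record9` lands. [cite: Balaban1987RG1, Lemma 4 (3.53) p.280, Thm 1 p.259 and Thm 3 p.264 (bookkeeping)] -/
theorem s_N09_of_shadow₅C (Rec : RecordPred N)
    (hshadow : ∀ (F : T4Family) (D : Datum F N) (w : WorldP), Rec F D w → ∃ D₅ : Datum F N, IsRecordOfRecord₅C F N D₅ w)
    (slot12 : ∀ (F : T4Family) (D₅ : Datum F N) (w : WorldP), IsRecordOfRecord₅C F N D₅ w →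
      ∀ θ : Stage5Params F N, θ.Admissible → D₅ = datumOfRecord₅ F N θ → (∀ P, w.up P = upOfRecord₅C F N θ P) →
        ∀ P : B12.RunParams, B12Sec2to5.Lemma4Printed (θ.res.X P).F12 (θ.res.X P).c12)
    (slotT : ∀ (F : T4Family) (D₅ : Datum F N) (w : WorldP), IsRecordOfRecord₅C F N D₅ w →
      ∀ θ : Stage5Params F N, θ.Admissible → D₅ = datumOfRecord₅ F N θ → w.C = D₅.C → w.γ = θ.γ → ∀ P : B12.RunParams,
        ((datumOfRecord₅ F N θ).C P).flow.InInterval θ.γ P.K → ∀ k, k ≤ P.K → ((datumOfRecord₅ F N θ).C P).IndAss k) :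
    S_N09 Rec := by
  intro F D w hR P
  obtain ⟨D₅, h₅⟩ := hshadow F D w hR
  exact b12_main_of_isRecordOfRecord₅C_of_sockets h₅ (slot12 F D₅ w h₅) (slotT F D₅ w h₅) P

/-- **Any node statement transfers along a same-world shadow** (generic form of `atWorld_of_isRecordOfRecord₉C` for `AtRecord`-shaped stubs): if `X` holds at every run of
every ₅C record's world and every record of `Rec` has a ₅C shadow with the same world, then `AtRecord Rec X`. [cite: Balaban1987RG1, Thm 3 p.264 (bookkeeping)] -/
theorem atRecord_of_shadow₅C (Rec : RecordPred N) (X : Dag.Leaves → Prop)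
    (hshadow : ∀ (F : T4Family) (D : Datum F N) (w : WorldP), Rec F D w → ∃ D₅ : Datum F N, IsRecordOfRecord₅C F N D₅ w)
    (hX : ∀ (F : T4Family) (D₅ : Datum F N) (w : WorldP), IsRecordOfRecord₅C F N D₅ w → ∀ P : B12.RunParams, X (leavesP w P)) :
    AtRecord Rec X := by
  intro F D w hR P
  obtain ⟨D₅, h₅⟩ := hshadow F D w hR
  exact hX F D₅ w h₅ P

/-! ## §6 Bookkeeping: `S_N09 Rec` is the N09 conjunct of the K2 join (`FlowBounds_of`'s fourth argument — cited, not restated: `N10AtRecord.flowBounds_of_N10`) -/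

/-- The N09 conjunct READ OFF the cluster statement: `FlowBounds Rec → S_N09 Rec` (the fourth component of K2 «FlowBounds»; the converse assembly is
`YMDAG.UVSplit.FlowBounds_of` ∕ `N10AtRecord.flowBounds_of_N10`, by name). [cite: Balaban1987RG1, Thm 3 p.264 (bookkeeping)] -/
theorem s_N09_of_flowBounds (Rec : RecordPred N) (h : FlowBounds Rec) : S_N09 Rec :=
  fun F D w hR P => (h F D w hR P).2.2.2.1

end Summit.QuantumFields.YangMills.BalabanUVNodes.N09AtRecord

end
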